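import Mathlib
import Summits.ValiantsHypothesis.ValiantsHypothesis.Theorems.LacunarySymmetroidMatrixDescartesOsculationLawRecursionTransferStep
import Summits.ValiantsHypothesis.ValiantsHypothesis.Theorems.LacunarySymmetroidMatrixDescartesOsculationLawRecursionStep
import Summits.ValiantsHypothesis.ValiantsHypothesis.Theorems.LacunarySymmetroidMatrixDescartesOsculationLawRecursionTwoLetters

/-!
# `MatrixDescartes` (stmt-ValiantsHypothesis-18050), line `osculation_law`, stub `stub_recursion` — ASSEMBLY:
# `OsculationLaw → PosKPlusLogSqLaw` MODULO the density of the node-local general-position family (`stub_gpNodeDense`)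

Helper file (`--supports stmt-ValiantsHypothesis-18050 --as helper`; cell val-lit, seat val-port-3 g1, merged desk g12,
RULINGS #283/#284 (b); shape agreed on the bus with val-lit-p4 g13 / val-lit-p8 g12 / val-lit-p7 g13).  Closes NO item.

Inputs BY NAME: the transfer induction `RecursionTransfer.posKPlusLogSq_of_nodeSteps_reindex` (val-port-3 g1,
`…RecursionTransferStep`), the analytic node inequality `OsculationRecursion.zmult_node_le` (val-lit-p4 g13,
`…RecursionStep`: two peels per letter via `OsculationPeel.peelInequality_rank_all`, the split of the top letter
`YᵀY − c•1` from val-lit-p8 g12's `…RecursionSplit`), and the two-letter base `OsculationRecursion.zmult_two_letters`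
(val-lit-p7 g13, `…RecursionTwoLetters`).

* `zmult_one_letter` — a one-letter pencil `X^{d₀} • S₀` has no positive det-root (level `K + 1 = 1`);
* `isSymm_conj` — `Wᵀ A W` is symmetric when `A` is;
* `recursion_of_family` — the induction for ANY node family entering from the third letter and ANY node cost of
  envelope shape (route-independent: a crossing-tolerant peel only changes the cost);
* **`recursion_of_gpNodeDense (hGP) (hO) : ∃ C, ∀ m K, PosRootLawAt m K (2 ^ (C * (K + Nat.log 2 m ^ 2)))`** — the
  line's `stub_recursion` target `PosKPlusLogSqLaw` UNFOLDED (δ-checked against a verbatim copy of the line's definitions),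
  from `hO` = the line's `OsculationLaw` UNFOLDED and `hGP` = DENSITY, for every size `m`, every level `K ≥ 2` (i.e.
  inserting the `(K+1)`-st ≥ third letter) and every normal-form support `d` (`StrictMono d`, `d 0 = 0`), of the
  NODE-LOCAL GENERAL-POSITION FAMILY among the symmetric `(K+1)`-letter pencils on `Fin m ⊕ Fin 0`: the pencils `S` whose
  top letter splits as `S_K = YᵀY − c•1` (`det Y ≠ 0`, `c > 0`) such that the two node pencils `(d₀, S₀) = (d∘castSucc,
  −S∘castSucc)` (arc `c·tᴺ`) and `(d, S₁) = Y⁻ᵀ(S∘castSucc, −c•1)Y⁻¹` (arc `1·tᴺ`), `N = d (Fin.last K)`, satisfy the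
  VERBATIM general-position hypothesis list of the line's `PeelInequalityAt m` at `s = 0` (pencil determinant `≢ 0`,
  finite osculation set, every osculation point smooth and off the arc), and whose first `K` letters have a determinant
  with only SIMPLE positive roots.  Levels `K + 1 ≤ 2` use the trivial family (every symmetric pencil) with the direct
  bounds `zmult_one_letter` / `zmult_two_letters`, so NO general position is asked below three letters (val-lit-p7 g13's
  (F0)/(F1)).  The node cost `A m K = 2·2^{C₀(K+1+L)} + 4·2^{C₀(K+L)} + 6m` (`L = log₂² m`, `C₀` the osculation-law
  exponent) is absorbed by `RecursionTransfer.exists_exponent_envelope` (`a = b = 6`).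

So, once wired (`stub_recursion hP hO := …recursion_of_gpNodeDense stub_gpNodeDense hO`, `hP` unused — the peel
inequality is a theorem, `OsculationPeel.peelInequality_rank_all`), the osculation-law line's open content is exactly
{`stub_osculationLaw` (the LAW, the crux), `stub_gpNodeDense` (R6(a): density of the node family above)}.
[folklore] bookkeeping only.  Honest framing: the LAW, the density stub, `MatrixDescartes` (18050), Conjecture B and
VP ≠ VNP are NOT proved here; no summit statement is proved by this file.
-/

set_option linter.dupNamespace false

namespace Summit.ValiantsHypothesis.ValiantsHypothesis.Theorems.LacunarySymmetroidMatrixDescartes.RecursionTransfer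

open Polynomial Matrix Filter Topology
open scoped BigOperators
open Summit.ValiantsHypothesis.ValiantsHypothesis.Theorems.MatrixDescartes.Negative (PosRootLawAt)

/-! ## Small inputs -/

/-- `Wᵀ A W` is symmetric when `A` is. [folklore] -/
theorem isSymm_conj {ι : Type*} [Fintype ι] (W : Matrix ι ι ℝ) {A : Matrix ι ι ℝ} (hA : A.IsSymm) :
    (Wᵀ * A * W).IsSymm := by
  unfold Matrix.IsSymm at hA ⊢
  rw [Matrix.transpose_mul, Matrix.transpose_mul, Matrix.transpose_transpose, hA, Matrix.mul_assoc]

/-- **Level `K + 1 = 1`: a one-letter pencil has no positive det-root** (`det (X^{d₀} • S₀) = X^{d₀·|ι|} · det S₀` is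
the zero polynomial or has `0` as its only root). [folklore] -/
theorem zmult_one_letter {ι : Type*} [Fintype ι] [DecidableEq ι] (d : Fin 1 → ℕ) (S : Fin 1 → Matrix ι ι ℝ) :
    Multiset.card (((∑ l, (X : ℝ[X]) ^ d l • (S l).map C).det.roots.filter (fun t => 0 < t))) = 0 := by
  classical
  have hsum : (∑ l, (X : ℝ[X]) ^ d l • (S l).map C) = (X : ℝ[X]) ^ d 0 • (S 0).map C := by
    rw [Fin.sum_univ_one]
  have hmap : ((S 0).map C).det = C ((S 0).det) := by
    rw [← RingHom.mapMatrix_apply, ← RingHom.map_det]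
  have hdet : (∑ l, (X : ℝ[X]) ^ d l • (S l).map C).det = (X : ℝ[X]) ^ (d 0 * Fintype.card ι) * C ((S 0).det) := by
    rw [hsum, Matrix.det_smul, hmap, ← pow_mul]
  rw [Multiset.card_eq_zero, Multiset.filter_eq_nil]
  intro t ht hpos
  obtain ⟨hne, hroot⟩ := Polynomial.mem_roots'.mp ht
  rw [hdet] at hne hroot
  rw [Polynomial.IsRoot, Polynomial.eval_mul, Polynomial.eval_pow, Polynomial.eval_X, Polynomial.eval_C] at hroot
  rcases mul_eq_zero.mp hroot with h | h
  · exact absurd h (pow_pos hpos _).ne'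
  · exact hne (by rw [h, map_zero, mul_zero])

/-! ## The induction with a general-position family entering from the third letter -/

/-- **Recursion from a node family above two letters.**  For every size `m`, level `K ≥ 2` and normal-form support
`d`, let `G m K d` be a family of symmetric `(K+1)`-letter pencils on `Fin m ⊕ Fin 0`, dense among the symmetric ones,
on which the node inequality `Z₊mult ≤ 4·#distinct(first K letters) + A m K` holds for a cost of envelope shape
`A m K ≤ a·2^{C₀(K+1+L)} + b·m` (`L = log₂² m`).  Then `∃ C, ∀ m K, PosRootLawAt m K (2^{C(K+L)})`.  Levels one and
two letters need NO family: they are served on the full (trivially dense) family by `zmult_one_letter` and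
val-lit-p7 g13's `OsculationRecursion.zmult_two_letters` (transported to `Fin m ⊕ Fin 0` along `Equiv.sumEmpty`).
[folklore] -/
theorem recursion_of_family (A : ℕ → ℕ → ℕ) (a b C₀ : ℕ)
    (hA : ∀ m K, A m K ≤ a * 2 ^ (C₀ * (K + 1 + Nat.log 2 m ^ 2)) + b * m)
    (G : (m K : ℕ) → (Fin (K + 1) → ℕ) → Set (Fin (K + 1) → Matrix (Fin m ⊕ Fin 0) (Fin m ⊕ Fin 0) ℝ))
    (hGdense : ∀ (m K : ℕ), 2 ≤ K → ∀ (d : Fin (K + 1) → ℕ), StrictMono d → d 0 = 0 →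
      ∀ T : Fin (K + 1) → Matrix (Fin m ⊕ Fin 0) (Fin m ⊕ Fin 0) ℝ, (∀ l, (T l).IsSymm) → T ∈ closure (G m K d))
    (hGsymm : ∀ (m K : ℕ) (d : Fin (K + 1) → ℕ), ∀ S ∈ G m K d, ∀ l, (S l).IsSymm)
    (hGstep : ∀ (m K : ℕ), 2 ≤ K → ∀ (d : Fin (K + 1) → ℕ), StrictMono d → d 0 = 0 → ∀ S ∈ G m K d,
      Multiset.card (((∑ l, (X : ℝ[X]) ^ d l • (S l).map C).det.roots.filter (fun t => 0 < t))) ≤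
        4 * ((∑ l : Fin K, (X : ℝ[X]) ^ d (Fin.castSucc l) •
            (S (Fin.castSucc l)).map C).det.roots.toFinset.filter (fun t => 0 < t)).card + A m K) :
    ∃ C : ℕ, ∀ m K : ℕ, PosRootLawAt m K (2 ^ (C * (K + Nat.log 2 m ^ 2))) := by
  classical
  refine posKPlusLogSq_of_nodeSteps_reindex (fun m => Fin m ⊕ Fin 0) (fun m => Equiv.sumEmpty (Fin m) (Fin 0))
    (fun m K => A m K + m) a (b + 1) C₀ (fun m K => ?_)
    (fun m K d => {S | (∀ l, (S l).IsSymm) ∧ (K < 2 ∨ S ∈ G m K d)})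
    (fun m K d _ _ S hS => hS.1) (fun m K d hd h0 S hS => ?_) (fun m K d hd h0 T hT => ?_)
  · -- the padded cost is of the envelope's shape
    have h := hA m K
    linarith [h]
  · -- the node step, by level
    have hSsymm : ∀ l, (S l).IsSymm := hS.1
    rcases lt_or_ge K 2 with hK | hK
    · -- one or two letters: direct bounds, no general position asked
      interval_cases K
      · rw [zmult_one_letter d S]
        exact Nat.zero_le _
      · have h2 := OsculationRecursion.zmult_two_letters d
          (fun l => Matrix.reindex (Equiv.sumEmpty (Fin m) (Fin 0)) (Equiv.sumEmpty (Fin m) (Fin 0)) (S l))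
        have hdet : (∑ l, (X : ℝ[X]) ^ d l • ((fun l => Matrix.reindex (Equiv.sumEmpty (Fin m) (Fin 0))
            (Equiv.sumEmpty (Fin m) (Fin 0)) (S l)) l).map C).det = (∑ l, (X : ℝ[X]) ^ d l • (S l).map C).det :=
          DenseTransfer.det_pencil_reindex _ d S
        rw [hdet] at h2
        exact h2.trans (by omega)
    · have hSG : S ∈ G m K d := by
        rcases hS.2 with h | h
        · omega
        · exact h
      have hstep := hGstep m K hK d hd h0 S hSG
      have e : (∑ l, (X : ℝ[X]) ^ (Fin.init d) l • ((Fin.init S) l).map C) =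
          ∑ l : Fin K, (X : ℝ[X]) ^ d (Fin.castSucc l) • (S (Fin.castSucc l)).map C := rfl
      rw [e]
      omega
  · -- density, by level
    rcases lt_or_ge K 2 with hK | hK
    · exact subset_closure (show T ∈ {S | (∀ l, (S l).IsSymm) ∧ (K < 2 ∨ S ∈ G m K d)} from ⟨hT, Or.inl hK⟩)
    · have hsub : G m K d ⊆ {S | (∀ l, (S l).IsSymm) ∧ (K < 2 ∨ S ∈ G m K d)} :=
        fun S hS => ⟨hGsymm m K d S hS, Or.inr hS⟩
      exact closure_mono hsub (hGdense m K hK d hd h0 T hT)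

/-! ## The assembly -/

/-- **`stub_recursion` modulo node density: `OsculationLaw → PosKPlusLogSqLaw`** (both UNFOLDED; see the module
docstring for the node family).  `hGP` is the line's one new honest stub `stub_gpNodeDense` (R6(a)). [folklore] -/
theorem recursion_of_gpNodeDense
    (hGP : ∀ (m K : ℕ), 2 ≤ K → ∀ (d : Fin (K + 1) → ℕ), StrictMono d → d 0 = 0 →
      ∀ T : Fin (K + 1) → Matrix (Fin m ⊕ Fin 0) (Fin m ⊕ Fin 0) ℝ, (∀ l, (T l).IsSymm) →
        T ∈ closure {S : Fin (K + 1) → Matrix (Fin m ⊕ Fin 0) (Fin m ⊕ Fin 0) ℝ |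
      (∀ l, (S l).IsSymm) ∧
      ∃ (Y : Matrix (Fin m ⊕ Fin 0) (Fin m ⊕ Fin 0) ℝ) (c : ℝ) (d₀ : Fin K → ℕ) (S₀ : Fin K → Matrix (Fin m ⊕ Fin 0) (Fin m ⊕ Fin 0) ℝ) (S₁ : Fin (K + 1) → Matrix (Fin m ⊕ Fin 0) (Fin m ⊕ Fin 0) ℝ),
        Y.det ≠ 0 ∧ 0 < c ∧ S (Fin.last K) = Yᵀ * Y - c • (1 : Matrix (Fin m ⊕ Fin 0) (Fin m ⊕ Fin 0) ℝ) ∧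
        (∀ l, d₀ l = d (Fin.castSucc l)) ∧ (∀ l, S₀ l = -S (Fin.castSucc l)) ∧
        (∀ l, S₁ l = (Y⁻¹)ᵀ * (Fin.snoc (fun l => S (Fin.castSucc l)) (-(c • (1 : Matrix (Fin m ⊕ Fin 0) (Fin m ⊕ Fin 0) ℝ))) :
          Fin (K + 1) → Matrix (Fin m ⊕ Fin 0) (Fin m ⊕ Fin 0) ℝ) l * Y⁻¹) ∧
        (∑ l, (X : ℝ[X]) ^ d₀ l • (S₀ l).map Polynomial.C).det ≠ 0 ∧
        {p : Fin 2 → ℝ | 0 < p 0 ∧ 0 < p 1 ∧ MvPolynomial.eval p (∑ l, (MvPolynomial.X (0 : Fin 2) : MvPolynomial (Fin 2) ℝ) ^ d₀ l • (S₀ l).map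
          (MvPolynomial.C : ℝ →+* MvPolynomial (Fin 2) ℝ) + (MvPolynomial.X (1 : Fin 2) : MvPolynomial (Fin 2) ℝ) • (Matrix.fromBlocks 1 0 0 0 : Matrix (Fin m ⊕
          Fin 0) (Fin m ⊕ Fin 0) ℝ).map (MvPolynomial.C : ℝ →+* MvPolynomial (Fin 2) ℝ)).det = 0 ∧ MvPolynomial.eval p (MvPolynomial.X 0 * MvPolynomial.pderiv 0
          (MvPolynomial.X 0 * MvPolynomial.pderiv 0 (∑ l, (MvPolynomial.X (0 : Fin 2) : MvPolynomial (Fin 2) ℝ) ^ d₀ l • (S₀ l).map (MvPolynomial.C : ℝ →+*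
          MvPolynomial (Fin 2) ℝ) + (MvPolynomial.X (1 : Fin 2) : MvPolynomial (Fin 2) ℝ) • (Matrix.fromBlocks 1 0 0 0 : Matrix (Fin m ⊕ Fin 0) (Fin m ⊕ Fin 0)
          ℝ).map (MvPolynomial.C : ℝ →+* MvPolynomial (Fin 2) ℝ)).det) * (MvPolynomial.X 1 * MvPolynomial.pderiv 1 (∑ l, (MvPolynomial.X (0 : Fin 2) :
          MvPolynomial (Fin 2) ℝ) ^ d₀ l • (S₀ l).map (MvPolynomial.C : ℝ →+* MvPolynomial (Fin 2) ℝ) + (MvPolynomial.X (1 : Fin 2) : MvPolynomial (Fin 2) ℝ) •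
          (Matrix.fromBlocks 1 0 0 0 : Matrix (Fin m ⊕ Fin 0) (Fin m ⊕ Fin 0) ℝ).map (MvPolynomial.C : ℝ →+* MvPolynomial (Fin 2) ℝ)).det) ^ 2 - 2 *
          (MvPolynomial.X 0 * MvPolynomial.pderiv 0 (MvPolynomial.X 1 * MvPolynomial.pderiv 1 (∑ l, (MvPolynomial.X (0 : Fin 2) : MvPolynomial (Fin 2) ℝ) ^ d₀ l
          • (S₀ l).map (MvPolynomial.C : ℝ →+* MvPolynomial (Fin 2) ℝ) + (MvPolynomial.X (1 : Fin 2) : MvPolynomial (Fin 2) ℝ) • (Matrix.fromBlocks 1 0 0 0 :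
          Matrix (Fin m ⊕ Fin 0) (Fin m ⊕ Fin 0) ℝ).map (MvPolynomial.C : ℝ →+* MvPolynomial (Fin 2) ℝ)).det)) * (MvPolynomial.X 0 * MvPolynomial.pderiv 0 (∑ l,
          (MvPolynomial.X (0 : Fin 2) : MvPolynomial (Fin 2) ℝ) ^ d₀ l • (S₀ l).map (MvPolynomial.C : ℝ →+* MvPolynomial (Fin 2) ℝ) + (MvPolynomial.X (1 : Fin
          2) : MvPolynomial (Fin 2) ℝ) • (Matrix.fromBlocks 1 0 0 0 : Matrix (Fin m ⊕ Fin 0) (Fin m ⊕ Fin 0) ℝ).map (MvPolynomial.C : ℝ →+* MvPolynomial (Fin 2)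
          ℝ)).det) * (MvPolynomial.X 1 * MvPolynomial.pderiv 1 (∑ l, (MvPolynomial.X (0 : Fin 2) : MvPolynomial (Fin 2) ℝ) ^ d₀ l • (S₀ l).map (MvPolynomial.C :
          ℝ →+* MvPolynomial (Fin 2) ℝ) + (MvPolynomial.X (1 : Fin 2) : MvPolynomial (Fin 2) ℝ) • (Matrix.fromBlocks 1 0 0 0 : Matrix (Fin m ⊕ Fin 0) (Fin m ⊕
          Fin 0) ℝ).map (MvPolynomial.C : ℝ →+* MvPolynomial (Fin 2) ℝ)).det) + MvPolynomial.X 1 * MvPolynomial.pderiv 1 (MvPolynomial.X 1 * MvPolynomial.pderiv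
          1 (∑ l, (MvPolynomial.X (0 : Fin 2) : MvPolynomial (Fin 2) ℝ) ^ d₀ l • (S₀ l).map (MvPolynomial.C : ℝ →+* MvPolynomial (Fin 2) ℝ) + (MvPolynomial.X (1
          : Fin 2) : MvPolynomial (Fin 2) ℝ) • (Matrix.fromBlocks 1 0 0 0 : Matrix (Fin m ⊕ Fin 0) (Fin m ⊕ Fin 0) ℝ).map (MvPolynomial.C : ℝ →+* MvPolynomial
          (Fin 2) ℝ)).det) * (MvPolynomial.X 0 * MvPolynomial.pderiv 0 (∑ l, (MvPolynomial.X (0 : Fin 2) : MvPolynomial (Fin 2) ℝ) ^ d₀ l • (S₀ l).map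
          (MvPolynomial.C : ℝ →+* MvPolynomial (Fin 2) ℝ) + (MvPolynomial.X (1 : Fin 2) : MvPolynomial (Fin 2) ℝ) • (Matrix.fromBlocks 1 0 0 0 : Matrix (Fin m ⊕
          Fin 0) (Fin m ⊕ Fin 0) ℝ).map (MvPolynomial.C : ℝ →+* MvPolynomial (Fin 2) ℝ)).det) ^ 2) = 0}.Finite ∧
        (∀ p ∈ {p : Fin 2 → ℝ | 0 < p 0 ∧ 0 < p 1 ∧ MvPolynomial.eval p (∑ l, (MvPolynomial.X (0 : Fin 2) : MvPolynomial (Fin 2) ℝ) ^ d₀ l • (S₀ l).map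
          (MvPolynomial.C : ℝ →+* MvPolynomial (Fin 2) ℝ) + (MvPolynomial.X (1 : Fin 2) : MvPolynomial (Fin 2) ℝ) • (Matrix.fromBlocks 1 0 0 0 : Matrix (Fin m ⊕
          Fin 0) (Fin m ⊕ Fin 0) ℝ).map (MvPolynomial.C : ℝ →+* MvPolynomial (Fin 2) ℝ)).det = 0 ∧ MvPolynomial.eval p (MvPolynomial.X 0 * MvPolynomial.pderiv 0
          (MvPolynomial.X 0 * MvPolynomial.pderiv 0 (∑ l, (MvPolynomial.X (0 : Fin 2) : MvPolynomial (Fin 2) ℝ) ^ d₀ l • (S₀ l).map (MvPolynomial.C : ℝ →+*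
          MvPolynomial (Fin 2) ℝ) + (MvPolynomial.X (1 : Fin 2) : MvPolynomial (Fin 2) ℝ) • (Matrix.fromBlocks 1 0 0 0 : Matrix (Fin m ⊕ Fin 0) (Fin m ⊕ Fin 0)
          ℝ).map (MvPolynomial.C : ℝ →+* MvPolynomial (Fin 2) ℝ)).det) * (MvPolynomial.X 1 * MvPolynomial.pderiv 1 (∑ l, (MvPolynomial.X (0 : Fin 2) :
          MvPolynomial (Fin 2) ℝ) ^ d₀ l • (S₀ l).map (MvPolynomial.C : ℝ →+* MvPolynomial (Fin 2) ℝ) + (MvPolynomial.X (1 : Fin 2) : MvPolynomial (Fin 2) ℝ) •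
          (Matrix.fromBlocks 1 0 0 0 : Matrix (Fin m ⊕ Fin 0) (Fin m ⊕ Fin 0) ℝ).map (MvPolynomial.C : ℝ →+* MvPolynomial (Fin 2) ℝ)).det) ^ 2 - 2 *
          (MvPolynomial.X 0 * MvPolynomial.pderiv 0 (MvPolynomial.X 1 * MvPolynomial.pderiv 1 (∑ l, (MvPolynomial.X (0 : Fin 2) : MvPolynomial (Fin 2) ℝ) ^ d₀ l
          • (S₀ l).map (MvPolynomial.C : ℝ →+* MvPolynomial (Fin 2) ℝ) + (MvPolynomial.X (1 : Fin 2) : MvPolynomial (Fin 2) ℝ) • (Matrix.fromBlocks 1 0 0 0 :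
          Matrix (Fin m ⊕ Fin 0) (Fin m ⊕ Fin 0) ℝ).map (MvPolynomial.C : ℝ →+* MvPolynomial (Fin 2) ℝ)).det)) * (MvPolynomial.X 0 * MvPolynomial.pderiv 0 (∑ l,
          (MvPolynomial.X (0 : Fin 2) : MvPolynomial (Fin 2) ℝ) ^ d₀ l • (S₀ l).map (MvPolynomial.C : ℝ →+* MvPolynomial (Fin 2) ℝ) + (MvPolynomial.X (1 : Fin
          2) : MvPolynomial (Fin 2) ℝ) • (Matrix.fromBlocks 1 0 0 0 : Matrix (Fin m ⊕ Fin 0) (Fin m ⊕ Fin 0) ℝ).map (MvPolynomial.C : ℝ →+* MvPolynomial (Fin 2)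
          ℝ)).det) * (MvPolynomial.X 1 * MvPolynomial.pderiv 1 (∑ l, (MvPolynomial.X (0 : Fin 2) : MvPolynomial (Fin 2) ℝ) ^ d₀ l • (S₀ l).map (MvPolynomial.C :
          ℝ →+* MvPolynomial (Fin 2) ℝ) + (MvPolynomial.X (1 : Fin 2) : MvPolynomial (Fin 2) ℝ) • (Matrix.fromBlocks 1 0 0 0 : Matrix (Fin m ⊕ Fin 0) (Fin m ⊕
          Fin 0) ℝ).map (MvPolynomial.C : ℝ →+* MvPolynomial (Fin 2) ℝ)).det) + MvPolynomial.X 1 * MvPolynomial.pderiv 1 (MvPolynomial.X 1 * MvPolynomial.pderiv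
          1 (∑ l, (MvPolynomial.X (0 : Fin 2) : MvPolynomial (Fin 2) ℝ) ^ d₀ l • (S₀ l).map (MvPolynomial.C : ℝ →+* MvPolynomial (Fin 2) ℝ) + (MvPolynomial.X (1
          : Fin 2) : MvPolynomial (Fin 2) ℝ) • (Matrix.fromBlocks 1 0 0 0 : Matrix (Fin m ⊕ Fin 0) (Fin m ⊕ Fin 0) ℝ).map (MvPolynomial.C : ℝ →+* MvPolynomial
          (Fin 2) ℝ)).det) * (MvPolynomial.X 0 * MvPolynomial.pderiv 0 (∑ l, (MvPolynomial.X (0 : Fin 2) : MvPolynomial (Fin 2) ℝ) ^ d₀ l • (S₀ l).map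
          (MvPolynomial.C : ℝ →+* MvPolynomial (Fin 2) ℝ) + (MvPolynomial.X (1 : Fin 2) : MvPolynomial (Fin 2) ℝ) • (Matrix.fromBlocks 1 0 0 0 : Matrix (Fin m ⊕
          Fin 0) (Fin m ⊕ Fin 0) ℝ).map (MvPolynomial.C : ℝ →+* MvPolynomial (Fin 2) ℝ)).det) ^ 2) = 0},
          MvPolynomial.eval p (MvPolynomial.pderiv 1 (∑ l, (MvPolynomial.X (0 : Fin 2) : MvPolynomial (Fin 2) ℝ) ^ d₀ l • (S₀ l).map (MvPolynomial.C : ℝ →+* MvPolynomial (Fin 2) ℝ) + (MvPolynomial.X (1 :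
          Fin 2) : MvPolynomial (Fin 2) ℝ) • (Matrix.fromBlocks 1 0 0 0 : Matrix (Fin m ⊕ Fin 0) (Fin m ⊕ Fin 0) ℝ).map (MvPolynomial.C : ℝ →+* MvPolynomial
          (Fin 2) ℝ)).det) ≠ 0 ∧ p 1 ≠ c * p 0 ^ d (Fin.last K)) ∧
        (∑ l, (X : ℝ[X]) ^ d l • (S₁ l).map Polynomial.C).det ≠ 0 ∧
        {p : Fin 2 → ℝ | 0 < p 0 ∧ 0 < p 1 ∧ MvPolynomial.eval p (∑ l, (MvPolynomial.X (0 : Fin 2) : MvPolynomial (Fin 2) ℝ) ^ d l • (S₁ l).map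
          (MvPolynomial.C : ℝ →+* MvPolynomial (Fin 2) ℝ) + (MvPolynomial.X (1 : Fin 2) : MvPolynomial (Fin 2) ℝ) • (Matrix.fromBlocks 1 0 0 0 : Matrix (Fin m ⊕
          Fin 0) (Fin m ⊕ Fin 0) ℝ).map (MvPolynomial.C : ℝ →+* MvPolynomial (Fin 2) ℝ)).det = 0 ∧ MvPolynomial.eval p (MvPolynomial.X 0 * MvPolynomial.pderiv 0
          (MvPolynomial.X 0 * MvPolynomial.pderiv 0 (∑ l, (MvPolynomial.X (0 : Fin 2) : MvPolynomial (Fin 2) ℝ) ^ d l • (S₁ l).map (MvPolynomial.C : ℝ →+*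
          MvPolynomial (Fin 2) ℝ) + (MvPolynomial.X (1 : Fin 2) : MvPolynomial (Fin 2) ℝ) • (Matrix.fromBlocks 1 0 0 0 : Matrix (Fin m ⊕ Fin 0) (Fin m ⊕ Fin 0)
          ℝ).map (MvPolynomial.C : ℝ →+* MvPolynomial (Fin 2) ℝ)).det) * (MvPolynomial.X 1 * MvPolynomial.pderiv 1 (∑ l, (MvPolynomial.X (0 : Fin 2) :
          MvPolynomial (Fin 2) ℝ) ^ d l • (S₁ l).map (MvPolynomial.C : ℝ →+* MvPolynomial (Fin 2) ℝ) + (MvPolynomial.X (1 : Fin 2) : MvPolynomial (Fin 2) ℝ) •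
          (Matrix.fromBlocks 1 0 0 0 : Matrix (Fin m ⊕ Fin 0) (Fin m ⊕ Fin 0) ℝ).map (MvPolynomial.C : ℝ →+* MvPolynomial (Fin 2) ℝ)).det) ^ 2 - 2 *
          (MvPolynomial.X 0 * MvPolynomial.pderiv 0 (MvPolynomial.X 1 * MvPolynomial.pderiv 1 (∑ l, (MvPolynomial.X (0 : Fin 2) : MvPolynomial (Fin 2) ℝ) ^ d l
          • (S₁ l).map (MvPolynomial.C : ℝ →+* MvPolynomial (Fin 2) ℝ) + (MvPolynomial.X (1 : Fin 2) : MvPolynomial (Fin 2) ℝ) • (Matrix.fromBlocks 1 0 0 0 :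
          Matrix (Fin m ⊕ Fin 0) (Fin m ⊕ Fin 0) ℝ).map (MvPolynomial.C : ℝ →+* MvPolynomial (Fin 2) ℝ)).det)) * (MvPolynomial.X 0 * MvPolynomial.pderiv 0 (∑ l,
          (MvPolynomial.X (0 : Fin 2) : MvPolynomial (Fin 2) ℝ) ^ d l • (S₁ l).map (MvPolynomial.C : ℝ →+* MvPolynomial (Fin 2) ℝ) + (MvPolynomial.X (1 : Fin 2)
          : MvPolynomial (Fin 2) ℝ) • (Matrix.fromBlocks 1 0 0 0 : Matrix (Fin m ⊕ Fin 0) (Fin m ⊕ Fin 0) ℝ).map (MvPolynomial.C : ℝ →+* MvPolynomial (Fin 2)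
          ℝ)).det) * (MvPolynomial.X 1 * MvPolynomial.pderiv 1 (∑ l, (MvPolynomial.X (0 : Fin 2) : MvPolynomial (Fin 2) ℝ) ^ d l • (S₁ l).map (MvPolynomial.C :
          ℝ →+* MvPolynomial (Fin 2) ℝ) + (MvPolynomial.X (1 : Fin 2) : MvPolynomial (Fin 2) ℝ) • (Matrix.fromBlocks 1 0 0 0 : Matrix (Fin m ⊕ Fin 0) (Fin m ⊕
          Fin 0) ℝ).map (MvPolynomial.C : ℝ →+* MvPolynomial (Fin 2) ℝ)).det) + MvPolynomial.X 1 * MvPolynomial.pderiv 1 (MvPolynomial.X 1 * MvPolynomial.pderiv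
          1 (∑ l, (MvPolynomial.X (0 : Fin 2) : MvPolynomial (Fin 2) ℝ) ^ d l • (S₁ l).map (MvPolynomial.C : ℝ →+* MvPolynomial (Fin 2) ℝ) + (MvPolynomial.X (1
          : Fin 2) : MvPolynomial (Fin 2) ℝ) • (Matrix.fromBlocks 1 0 0 0 : Matrix (Fin m ⊕ Fin 0) (Fin m ⊕ Fin 0) ℝ).map (MvPolynomial.C : ℝ →+* MvPolynomial
          (Fin 2) ℝ)).det) * (MvPolynomial.X 0 * MvPolynomial.pderiv 0 (∑ l, (MvPolynomial.X (0 : Fin 2) : MvPolynomial (Fin 2) ℝ) ^ d l • (S₁ l).map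
          (MvPolynomial.C : ℝ →+* MvPolynomial (Fin 2) ℝ) + (MvPolynomial.X (1 : Fin 2) : MvPolynomial (Fin 2) ℝ) • (Matrix.fromBlocks 1 0 0 0 : Matrix (Fin m ⊕
          Fin 0) (Fin m ⊕ Fin 0) ℝ).map (MvPolynomial.C : ℝ →+* MvPolynomial (Fin 2) ℝ)).det) ^ 2) = 0}.Finite ∧
        (∀ p ∈ {p : Fin 2 → ℝ | 0 < p 0 ∧ 0 < p 1 ∧ MvPolynomial.eval p (∑ l, (MvPolynomial.X (0 : Fin 2) : MvPolynomial (Fin 2) ℝ) ^ d l • (S₁ l).map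
          (MvPolynomial.C : ℝ →+* MvPolynomial (Fin 2) ℝ) + (MvPolynomial.X (1 : Fin 2) : MvPolynomial (Fin 2) ℝ) • (Matrix.fromBlocks 1 0 0 0 : Matrix (Fin m ⊕
          Fin 0) (Fin m ⊕ Fin 0) ℝ).map (MvPolynomial.C : ℝ →+* MvPolynomial (Fin 2) ℝ)).det = 0 ∧ MvPolynomial.eval p (MvPolynomial.X 0 * MvPolynomial.pderiv 0
          (MvPolynomial.X 0 * MvPolynomial.pderiv 0 (∑ l, (MvPolynomial.X (0 : Fin 2) : MvPolynomial (Fin 2) ℝ) ^ d l • (S₁ l).map (MvPolynomial.C : ℝ →+*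
          MvPolynomial (Fin 2) ℝ) + (MvPolynomial.X (1 : Fin 2) : MvPolynomial (Fin 2) ℝ) • (Matrix.fromBlocks 1 0 0 0 : Matrix (Fin m ⊕ Fin 0) (Fin m ⊕ Fin 0)
          ℝ).map (MvPolynomial.C : ℝ →+* MvPolynomial (Fin 2) ℝ)).det) * (MvPolynomial.X 1 * MvPolynomial.pderiv 1 (∑ l, (MvPolynomial.X (0 : Fin 2) :
          MvPolynomial (Fin 2) ℝ) ^ d l • (S₁ l).map (MvPolynomial.C : ℝ →+* MvPolynomial (Fin 2) ℝ) + (MvPolynomial.X (1 : Fin 2) : MvPolynomial (Fin 2) ℝ) •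
          (Matrix.fromBlocks 1 0 0 0 : Matrix (Fin m ⊕ Fin 0) (Fin m ⊕ Fin 0) ℝ).map (MvPolynomial.C : ℝ →+* MvPolynomial (Fin 2) ℝ)).det) ^ 2 - 2 *
          (MvPolynomial.X 0 * MvPolynomial.pderiv 0 (MvPolynomial.X 1 * MvPolynomial.pderiv 1 (∑ l, (MvPolynomial.X (0 : Fin 2) : MvPolynomial (Fin 2) ℝ) ^ d l
          • (S₁ l).map (MvPolynomial.C : ℝ →+* MvPolynomial (Fin 2) ℝ) + (MvPolynomial.X (1 : Fin 2) : MvPolynomial (Fin 2) ℝ) • (Matrix.fromBlocks 1 0 0 0 :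
          Matrix (Fin m ⊕ Fin 0) (Fin m ⊕ Fin 0) ℝ).map (MvPolynomial.C : ℝ →+* MvPolynomial (Fin 2) ℝ)).det)) * (MvPolynomial.X 0 * MvPolynomial.pderiv 0 (∑ l,
          (MvPolynomial.X (0 : Fin 2) : MvPolynomial (Fin 2) ℝ) ^ d l • (S₁ l).map (MvPolynomial.C : ℝ →+* MvPolynomial (Fin 2) ℝ) + (MvPolynomial.X (1 : Fin 2)
          : MvPolynomial (Fin 2) ℝ) • (Matrix.fromBlocks 1 0 0 0 : Matrix (Fin m ⊕ Fin 0) (Fin m ⊕ Fin 0) ℝ).map (MvPolynomial.C : ℝ →+* MvPolynomial (Fin 2)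
          ℝ)).det) * (MvPolynomial.X 1 * MvPolynomial.pderiv 1 (∑ l, (MvPolynomial.X (0 : Fin 2) : MvPolynomial (Fin 2) ℝ) ^ d l • (S₁ l).map (MvPolynomial.C :
          ℝ →+* MvPolynomial (Fin 2) ℝ) + (MvPolynomial.X (1 : Fin 2) : MvPolynomial (Fin 2) ℝ) • (Matrix.fromBlocks 1 0 0 0 : Matrix (Fin m ⊕ Fin 0) (Fin m ⊕
          Fin 0) ℝ).map (MvPolynomial.C : ℝ →+* MvPolynomial (Fin 2) ℝ)).det) + MvPolynomial.X 1 * MvPolynomial.pderiv 1 (MvPolynomial.X 1 * MvPolynomial.pderiv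
          1 (∑ l, (MvPolynomial.X (0 : Fin 2) : MvPolynomial (Fin 2) ℝ) ^ d l • (S₁ l).map (MvPolynomial.C : ℝ →+* MvPolynomial (Fin 2) ℝ) + (MvPolynomial.X (1
          : Fin 2) : MvPolynomial (Fin 2) ℝ) • (Matrix.fromBlocks 1 0 0 0 : Matrix (Fin m ⊕ Fin 0) (Fin m ⊕ Fin 0) ℝ).map (MvPolynomial.C : ℝ →+* MvPolynomial
          (Fin 2) ℝ)).det) * (MvPolynomial.X 0 * MvPolynomial.pderiv 0 (∑ l, (MvPolynomial.X (0 : Fin 2) : MvPolynomial (Fin 2) ℝ) ^ d l • (S₁ l).map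
          (MvPolynomial.C : ℝ →+* MvPolynomial (Fin 2) ℝ) + (MvPolynomial.X (1 : Fin 2) : MvPolynomial (Fin 2) ℝ) • (Matrix.fromBlocks 1 0 0 0 : Matrix (Fin m ⊕
          Fin 0) (Fin m ⊕ Fin 0) ℝ).map (MvPolynomial.C : ℝ →+* MvPolynomial (Fin 2) ℝ)).det) ^ 2) = 0},
          MvPolynomial.eval p (MvPolynomial.pderiv 1 (∑ l, (MvPolynomial.X (0 : Fin 2) : MvPolynomial (Fin 2) ℝ) ^ d l • (S₁ l).map (MvPolynomial.C : ℝ →+* MvPolynomial (Fin 2) ℝ) + (MvPolynomial.X (1 :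
          Fin 2) : MvPolynomial (Fin 2) ℝ) • (Matrix.fromBlocks 1 0 0 0 : Matrix (Fin m ⊕ Fin 0) (Fin m ⊕ Fin 0) ℝ).map (MvPolynomial.C : ℝ →+* MvPolynomial
          (Fin 2) ℝ)).det) ≠ 0 ∧ p 1 ≠ 1 * p 0 ^ d (Fin.last K)) ∧
        ((∑ l : Fin K, (X : ℝ[X]) ^ d (Fin.castSucc l) •
          (S (Fin.castSucc l)).map Polynomial.C).det.roots.filter (fun t => 0 < t)).Nodup})
    (hO : ∃ C : ℕ, ∀ m K : ℕ,
        ∀ (r s : ℕ), r + s = m → ∀ (d : Fin K → ℕ) (S : Fin K → Matrix (Fin r ⊕ Fin s) (Fin r ⊕ Fin s) ℝ), (∀ l, (S l).IsSymm) → {p : Fin 2 → ℝ | 0 < p 0 ∧ 0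
        < p 1 ∧ MvPolynomial.eval p (∑ l, (MvPolynomial.X (0 : Fin 2) : MvPolynomial (Fin 2) ℝ) ^ d l • (S l).map (MvPolynomial.C : ℝ →+* MvPolynomial (Fin 2)
        ℝ) + (MvPolynomial.X (1 : Fin 2) : MvPolynomial (Fin 2) ℝ) • (Matrix.fromBlocks 1 0 0 0 : Matrix (Fin r ⊕ Fin s) (Fin r ⊕ Fin s) ℝ).map
        (MvPolynomial.C : ℝ →+* MvPolynomial (Fin 2) ℝ)).det = 0 ∧ MvPolynomial.eval p (MvPolynomial.X 0 * MvPolynomial.pderiv 0 (MvPolynomial.X 0 *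
        MvPolynomial.pderiv 0 (∑ l, (MvPolynomial.X (0 : Fin 2) : MvPolynomial (Fin 2) ℝ) ^ d l • (S l).map (MvPolynomial.C : ℝ →+* MvPolynomial (Fin 2) ℝ) +
        (MvPolynomial.X (1 : Fin 2) : MvPolynomial (Fin 2) ℝ) • (Matrix.fromBlocks 1 0 0 0 : Matrix (Fin r ⊕ Fin s) (Fin r ⊕ Fin s) ℝ).map (MvPolynomial.C : ℝ
        →+* MvPolynomial (Fin 2) ℝ)).det) * (MvPolynomial.X 1 * MvPolynomial.pderiv 1 (∑ l, (MvPolynomial.X (0 : Fin 2) : MvPolynomial (Fin 2) ℝ) ^ d l • (S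
        l).map (MvPolynomial.C : ℝ →+* MvPolynomial (Fin 2) ℝ) + (MvPolynomial.X (1 : Fin 2) : MvPolynomial (Fin 2) ℝ) • (Matrix.fromBlocks 1 0 0 0 : Matrix
        (Fin r ⊕ Fin s) (Fin r ⊕ Fin s) ℝ).map (MvPolynomial.C : ℝ →+* MvPolynomial (Fin 2) ℝ)).det) ^ 2 - 2 * (MvPolynomial.X 0 * MvPolynomial.pderiv 0
        (MvPolynomial.X 1 * MvPolynomial.pderiv 1 (∑ l, (MvPolynomial.X (0 : Fin 2) : MvPolynomial (Fin 2) ℝ) ^ d l • (S l).map (MvPolynomial.C : ℝ →+*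
        MvPolynomial (Fin 2) ℝ) + (MvPolynomial.X (1 : Fin 2) : MvPolynomial (Fin 2) ℝ) • (Matrix.fromBlocks 1 0 0 0 : Matrix (Fin r ⊕ Fin s) (Fin r ⊕ Fin s)
        ℝ).map (MvPolynomial.C : ℝ →+* MvPolynomial (Fin 2) ℝ)).det)) * (MvPolynomial.X 0 * MvPolynomial.pderiv 0 (∑ l, (MvPolynomial.X (0 : Fin 2) :
        MvPolynomial (Fin 2) ℝ) ^ d l • (S l).map (MvPolynomial.C : ℝ →+* MvPolynomial (Fin 2) ℝ) + (MvPolynomial.X (1 : Fin 2) : MvPolynomial (Fin 2) ℝ) •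
        (Matrix.fromBlocks 1 0 0 0 : Matrix (Fin r ⊕ Fin s) (Fin r ⊕ Fin s) ℝ).map (MvPolynomial.C : ℝ →+* MvPolynomial (Fin 2) ℝ)).det) * (MvPolynomial.X 1 *
        MvPolynomial.pderiv 1 (∑ l, (MvPolynomial.X (0 : Fin 2) : MvPolynomial (Fin 2) ℝ) ^ d l • (S l).map (MvPolynomial.C : ℝ →+* MvPolynomial (Fin 2) ℝ) +
        (MvPolynomial.X (1 : Fin 2) : MvPolynomial (Fin 2) ℝ) • (Matrix.fromBlocks 1 0 0 0 : Matrix (Fin r ⊕ Fin s) (Fin r ⊕ Fin s) ℝ).map (MvPolynomial.C : ℝ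
        →+* MvPolynomial (Fin 2) ℝ)).det) + MvPolynomial.X 1 * MvPolynomial.pderiv 1 (MvPolynomial.X 1 * MvPolynomial.pderiv 1 (∑ l, (MvPolynomial.X (0 : Fin
        2) : MvPolynomial (Fin 2) ℝ) ^ d l • (S l).map (MvPolynomial.C : ℝ →+* MvPolynomial (Fin 2) ℝ) + (MvPolynomial.X (1 : Fin 2) : MvPolynomial (Fin 2) ℝ)
        • (Matrix.fromBlocks 1 0 0 0 : Matrix (Fin r ⊕ Fin s) (Fin r ⊕ Fin s) ℝ).map (MvPolynomial.C : ℝ →+* MvPolynomial (Fin 2) ℝ)).det) * (MvPolynomial.X 0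
        * MvPolynomial.pderiv 0 (∑ l, (MvPolynomial.X (0 : Fin 2) : MvPolynomial (Fin 2) ℝ) ^ d l • (S l).map (MvPolynomial.C : ℝ →+* MvPolynomial (Fin 2) ℝ)
        + (MvPolynomial.X (1 : Fin 2) : MvPolynomial (Fin 2) ℝ) • (Matrix.fromBlocks 1 0 0 0 : Matrix (Fin r ⊕ Fin s) (Fin r ⊕ Fin s) ℝ).map (MvPolynomial.C :
        ℝ →+* MvPolynomial (Fin 2) ℝ)).det) ^ 2) = 0}.Finite → {p : Fin 2 → ℝ | 0 < p 0 ∧ 0 < p 1 ∧ MvPolynomial.eval p (∑ l, (MvPolynomial.X (0 : Fin 2) :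
        MvPolynomial (Fin 2) ℝ) ^ d l • (S l).map (MvPolynomial.C : ℝ →+* MvPolynomial (Fin 2) ℝ) + (MvPolynomial.X (1 : Fin 2) : MvPolynomial (Fin 2) ℝ) •
        (Matrix.fromBlocks 1 0 0 0 : Matrix (Fin r ⊕ Fin s) (Fin r ⊕ Fin s) ℝ).map (MvPolynomial.C : ℝ →+* MvPolynomial (Fin 2) ℝ)).det = 0 ∧
        MvPolynomial.eval p (MvPolynomial.X 0 * MvPolynomial.pderiv 0 (MvPolynomial.X 0 * MvPolynomial.pderiv 0 (∑ l, (MvPolynomial.X (0 : Fin 2) :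
        MvPolynomial (Fin 2) ℝ) ^ d l • (S l).map (MvPolynomial.C : ℝ →+* MvPolynomial (Fin 2) ℝ) + (MvPolynomial.X (1 : Fin 2) : MvPolynomial (Fin 2) ℝ) •
        (Matrix.fromBlocks 1 0 0 0 : Matrix (Fin r ⊕ Fin s) (Fin r ⊕ Fin s) ℝ).map (MvPolynomial.C : ℝ →+* MvPolynomial (Fin 2) ℝ)).det) * (MvPolynomial.X 1 *
        MvPolynomial.pderiv 1 (∑ l, (MvPolynomial.X (0 : Fin 2) : MvPolynomial (Fin 2) ℝ) ^ d l • (S l).map (MvPolynomial.C : ℝ →+* MvPolynomial (Fin 2) ℝ) +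
        (MvPolynomial.X (1 : Fin 2) : MvPolynomial (Fin 2) ℝ) • (Matrix.fromBlocks 1 0 0 0 : Matrix (Fin r ⊕ Fin s) (Fin r ⊕ Fin s) ℝ).map (MvPolynomial.C : ℝ
        →+* MvPolynomial (Fin 2) ℝ)).det) ^ 2 - 2 * (MvPolynomial.X 0 * MvPolynomial.pderiv 0 (MvPolynomial.X 1 * MvPolynomial.pderiv 1 (∑ l, (MvPolynomial.X
        (0 : Fin 2) : MvPolynomial (Fin 2) ℝ) ^ d l • (S l).map (MvPolynomial.C : ℝ →+* MvPolynomial (Fin 2) ℝ) + (MvPolynomial.X (1 : Fin 2) : MvPolynomial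
        (Fin 2) ℝ) • (Matrix.fromBlocks 1 0 0 0 : Matrix (Fin r ⊕ Fin s) (Fin r ⊕ Fin s) ℝ).map (MvPolynomial.C : ℝ →+* MvPolynomial (Fin 2) ℝ)).det)) *
        (MvPolynomial.X 0 * MvPolynomial.pderiv 0 (∑ l, (MvPolynomial.X (0 : Fin 2) : MvPolynomial (Fin 2) ℝ) ^ d l • (S l).map (MvPolynomial.C : ℝ →+*
        MvPolynomial (Fin 2) ℝ) + (MvPolynomial.X (1 : Fin 2) : MvPolynomial (Fin 2) ℝ) • (Matrix.fromBlocks 1 0 0 0 : Matrix (Fin r ⊕ Fin s) (Fin r ⊕ Fin s)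
        ℝ).map (MvPolynomial.C : ℝ →+* MvPolynomial (Fin 2) ℝ)).det) * (MvPolynomial.X 1 * MvPolynomial.pderiv 1 (∑ l, (MvPolynomial.X (0 : Fin 2) :
        MvPolynomial (Fin 2) ℝ) ^ d l • (S l).map (MvPolynomial.C : ℝ →+* MvPolynomial (Fin 2) ℝ) + (MvPolynomial.X (1 : Fin 2) : MvPolynomial (Fin 2) ℝ) •
        (Matrix.fromBlocks 1 0 0 0 : Matrix (Fin r ⊕ Fin s) (Fin r ⊕ Fin s) ℝ).map (MvPolynomial.C : ℝ →+* MvPolynomial (Fin 2) ℝ)).det) + MvPolynomial.X 1 *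
        MvPolynomial.pderiv 1 (MvPolynomial.X 1 * MvPolynomial.pderiv 1 (∑ l, (MvPolynomial.X (0 : Fin 2) : MvPolynomial (Fin 2) ℝ) ^ d l • (S l).map
        (MvPolynomial.C : ℝ →+* MvPolynomial (Fin 2) ℝ) + (MvPolynomial.X (1 : Fin 2) : MvPolynomial (Fin 2) ℝ) • (Matrix.fromBlocks 1 0 0 0 : Matrix (Fin r ⊕
        Fin s) (Fin r ⊕ Fin s) ℝ).map (MvPolynomial.C : ℝ →+* MvPolynomial (Fin 2) ℝ)).det) * (MvPolynomial.X 0 * MvPolynomial.pderiv 0 (∑ l, (MvPolynomial.X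
        (0 : Fin 2) : MvPolynomial (Fin 2) ℝ) ^ d l • (S l).map (MvPolynomial.C : ℝ →+* MvPolynomial (Fin 2) ℝ) + (MvPolynomial.X (1 : Fin 2) : MvPolynomial
        (Fin 2) ℝ) • (Matrix.fromBlocks 1 0 0 0 : Matrix (Fin r ⊕ Fin s) (Fin r ⊕ Fin s) ℝ).map (MvPolynomial.C : ℝ →+* MvPolynomial (Fin 2) ℝ)).det) ^ 2) =
        0}.ncard ≤ 2 ^ (C * (K + Nat.log 2 m ^ 2))) :
    ∃ C : ℕ, ∀ m K : ℕ, PosRootLawAt m K (2 ^ (C * (K + Nat.log 2 m ^ 2))) := by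
  classical
  obtain ⟨C₀, hC₀⟩ := hO
  refine recursion_of_family
    (fun m K => 2 * 2 ^ (C₀ * (K + 1 + Nat.log 2 m ^ 2)) + 4 * 2 ^ (C₀ * (K + Nat.log 2 m ^ 2)) + 6 * m)
    6 6 C₀ (fun m K => ?_) _ hGP (fun m K d S hS => hS.1) ?_
  · -- cost envelope: `2^{C₀(K+L)} ≤ 2^{C₀(K+1+L)}`
    have h : 2 ^ (C₀ * (K + Nat.log 2 m ^ 2)) ≤ 2 ^ (C₀ * (K + 1 + Nat.log 2 m ^ 2)) :=
      Nat.pow_le_pow_right (by norm_num) (Nat.mul_le_mul_left _ (by omega))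
    omega
  intro m K hK d hd h0 S hS
  obtain ⟨hSsymm, Y, c, d₀, S₀, S₁, hY, hc, hlast, hd₀, hS₀, hS₁, hdet₀, hfin₀, hgp₀, hdet₁, hfin₁, hgp₁, hnodup⟩ :=
    hS
  -- the two node pencils are symmetric
  have hS₀symm : ∀ l, (S₀ l).IsSymm := fun l => by rw [hS₀]; exact (hSsymm _).neg
  have hS₁symm : ∀ l, (S₁ l).IsSymm := by
    intro l
    rw [hS₁]
    refine isSymm_conj _ ?_
    refine Fin.lastCases ?_ (fun i => ?_) l
    · rw [Fin.snoc_last]; exact (Matrix.isSymm_one.smul c).neg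
    · rw [Fin.snoc_castSucc]; exact hSsymm _
  -- the osculation law at the splitting (m, 0), for K and K + 1 letters
  have hO₀ := hC₀ m K m 0 rfl d₀ S₀ hS₀symm hfin₀
  have hO₁ := hC₀ m (K + 1) m 0 rfl d S₁ hS₁symm hfin₁
  have hnode := OsculationRecursion.zmult_node_le m K d S hSsymm Y hY c hc hlast d₀ S₀ hd₀ hS₀ S₁ hS₁ _ _
    hdet₀ hfin₀ hgp₀ hO₀ hdet₁ hfin₁ hgp₁ hO₁
  -- simple positive roots of the first K letters: multiplicity count = distinct count
  have hdist : Multiset.card (((∑ l : Fin K, (X : ℝ[X]) ^ d (Fin.castSucc l) •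
        (S (Fin.castSucc l)).map C).det.roots.filter (fun t => 0 < t))) =
      ((∑ l : Fin K, (X : ℝ[X]) ^ d (Fin.castSucc l) •
        (S (Fin.castSucc l)).map C).det.roots.toFinset.filter (fun t => 0 < t)).card := by
    rw [← Multiset.toFinset_filter, Multiset.toFinset_card_of_nodup hnodup]
  rw [hdist] at hnode
  omega

end Summit.ValiantsHypothesis.ValiantsHypothesis.Theorems.LacunarySymmetroidMatrixDescartes.RecursionTransfer
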